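import Summits.QuantumFields.YangMills.Theorems.BalabanUVNodesN19OscillatingLinksMultiscale
import Summits.QuantumFields.YangMills.Theorems.BalabanUVNodesN19SingleModeDegreeBudget

/-!
# YM-DAG node N19 (= NE7 proper) — MULTISCALE TELESCOPING, PART 4: SHIFTED ZIGZAGS, HINGES `|Σ_i|x_i| − c|` AND PIECEWISE-LINEAR LINKS of the
# ℓ¹-norm at `≲ d·log²t∕t` (the centred kinks that the |monomial| device could not move)

Cell `pub-ymgap`, HUMAN RULING D-0062 (Track A) ∕ D-0149 (work-bound push), R141 (C) wider-strategy seat `pub-ymgap-dag-n19-e` (strategy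
s3 = ALTERNATIVE CURRENCY), generation g30, module 4 (lineage module 121).  Route `Summits/QuantumFields/YangMills/Theses/BalabanUVNodes.lean`,
cluster item K3⁸ «SpineGivenEndpointR13SepCoPHV» (stmt-QuantumFields-27366); filed `--supports` that item `--as helper` (it proves no registered
stub).  COUNT-NEUTRAL: [folklore] approximation theory over Mathlib and the lineage BY NAME — PART 3 `…N19OscillatingLinksMultiscale`
(`exists_mvPolynomial_near_link_of_trigApprox`, `abs_arccos_cos_sub_partialSum_le`, `sum_inv_oddSq_le`, `sum_inv_odd_le`, `l1Norm_mem_Icc`), PART 2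
`…N19SingleModeL1Norm` (`exists_additiveJackson`) and PART 2b `…N19SingleModeDegreeBudget` (`exists_dyadicBudget`, `dyadicBudget_bounds`); no laws, no
scheme object, no Theses import; NOT a discharge claim.

CONTEXT — (v′) OF CURRENCY-MAP v8.  The |monomial| device (modules 115–117) prices links by their absolute coefficient mass at the vertex `s = 0`;
«centred powers `(S − c)^p` do NOT decompose into absolute monomials» (CURRENCY-MAP v8), so the HINGE `|S − c|` — the simplest link with a kink
INSIDE `(0, d)` — was left at nesting's `d∕√t`.  PART 3 priced the periodic zigzags `dist(S, Pℤ)`.  THIS MODULE shifts them and reads off the hinge: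
for `s, c ∈ [0, d]`, `|s − c| = dist(s − c, 2dℤ)`.
§1 `zigzag_eq_abs` (`(P∕2π)·arccos(cos(2πu∕P)) = |u|` for `|u| ≤ P∕2`) · ★ `exists_mvPolynomial_near_shiftedZigzag_l1Norm` (`dist(S − c, Pℤ)` within
`P∕(2π²N) + 2·(P(J+1)∕4 + (16d∕π)(1 + log N))∕2^J` at total degree `(J+1)(2^{J+2} + 600πNd∕P)`: PART 3 §2 with both cosine and sine coefficients,
`|cos φ| + |sin φ| ≤ 2`) · §2 ★★ `exists_mvPolynomial_near_hinge_l1Norm` (for EVERY `c ∈ [0, d]`: `|Σ_i|x_i| − c|` within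
`d∕(π²N) + (d(J+1) + (32d∕π)(1 + log N))∕2^J` at total degree `(J+1)(2^{J+2} + 300πN)` — READING `N ≍ 2^J∕(75π)`, `t ≍ (J+1)2^{J+3}`:
`≲ d·log t·(log t + 45)∕t·8`, i.e. `≲ d log²t∕t`, uniformly in the position `c` of the kink) · ★ `exists_mvPolynomial_near_piecewiseLinear_l1Norm`
(`α + βS + Σ_{j<K} w_j|S − c_j|`, `c_j ∈ [0, d]`: the affine part by the additive Jackson approximant, the kinks by §2; error
`|β|·dπ∕((J+1)2^{J+1}) + (Σ_j|w_j|)·(hinge bound)`) · §3 ★★ `exists_mvPolynomial_near_hinge_l1Norm_degree` (AT A PRESCRIBED DEGREE BUDGET: for all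
`t ≥ 18432 = 9·2^{11}` and `c ∈ [0, d]`, an `MvPolynomial` of total degree `≤ t` within `200·d·log₂t·(log₂t + 7)∕t` of `|Σ_i|x_i| − c|` on the cube —
the dyadic `J` of PART 2b and `N = ⌊2^{J+2}∕(300π)⌋ ≥ 1`).
READING for (v′) (honest): every piecewise-linear 1-Lipschitz link with total kink mass `W = Σ|w_j|` costs `≲ (1 + W)·d·log²t∕t` — the ridge rate
up to `log²` for convex∕concave links with bounded slope range and for all links with `h′` of bounded variation FINITELY supported; (v′) for GENERAL
Lipschitz links (unbounded kink count at bounded Lipschitz constant, e.g. `W ≍ t∕d` kinks of size `d∕t`) stays OPEN.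

HONEST FRAMING (binding).  Elementary and [folklore]; ONE-SIDED (upper bounds); NO consumer in the DAG today (an optimality map of the seat's own
currency, degree model); nothing of Bałaban's instantiated; NE7 NOT PRINTED, NOT proved; N19 NOT discharged; count-neutral.  One finite `T⁴` programme
at fixed `ε`; nothing continuum ∕ `ℝ⁴` ∕ OS ∕ mass-gap ∕ Clay.  0 `def` ∕ 0 `sorry`.
-/

noncomputable section

open Finset
open scoped Real

namespace Summit.QuantumFields.YangMills.Theorems.BalabanUVNodesN19HingeLinksMultiscale

open Summit.QuantumFields.YangMills.Theorems.BalabanUVNodesN19SingleModeL1Norm (exists_additiveJackson)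
open Summit.QuantumFields.YangMills.Theorems.BalabanUVNodesN19OscillatingLinksMultiscale
  (exists_mvPolynomial_near_link_of_trigApprox abs_arccos_cos_sub_partialSum_le sum_inv_oddSq_le sum_inv_odd_le l1Norm_mem_Icc)
open Summit.QuantumFields.YangMills.Theorems.BalabanUVNodesN19SingleModeDegreeBudget (exists_dyadicBudget dyadicBudget_bounds)

variable {ι : Type*} [Fintype ι]

/-! ## §1 ★ Shifted zigzags [folklore] -/

/-- `(P∕2π)·arccos(cos(2πu∕P)) = |u|` for `|u| ≤ P∕2`: the zigzag `dist(·, Pℤ)` is `|·|` on its central period. [bookkeeping] -/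
theorem zigzag_eq_abs {P u : ℝ} (hP : 0 < P) (hu : |u| ≤ P / 2) :
    P / (2 * π) * Real.arccos (Real.cos (2 * π * u / P)) = |u| := by
  have hπ := Real.pi_pos
  have habs : Real.arccos (Real.cos (2 * π * u / P)) = |2 * π * u / P| := by
    rw [← Real.cos_abs]
    refine Real.arccos_cos (abs_nonneg _) ?_
    rw [abs_div, abs_of_pos hP, div_le_iff₀ hP, abs_mul, abs_of_pos (by positivity : (0 : ℝ) < 2 * π)]
    nlinarith
  rw [habs, abs_div, abs_of_pos hP, abs_mul, abs_of_pos (by positivity : (0 : ℝ) < 2 * π)]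
  field_simp

/-- ★ **SHIFTED ZIGZAGS.**  For `P > 0`, a shift `c`, every `J` and `N ≥ 1` there is `Q : MvPolynomial ι ℝ` of total degree
`≤ (J+1)(2^{J+2} + 150·(4πN∕P)·d)` with, on `[−1,1]^ι` (`S(x) = Σ_i|x_i|`),
`|(P∕2π)·arccos(cos(2π(S(x) − c)∕P)) − Q(x)| ≤ P∕(2π²N) + 2·(P(J+1)∕4 + (16d∕π)(1 + log N))∕2^J` — PART 3's zigzag bound doubled
(`cos(ω(s − c)) = cos(ωc)cos(ωs) + sin(ωc)sin(ωs)`, `|cos| + |sin| ≤ 2`). [folklore] -/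
theorem exists_mvPolynomial_near_shiftedZigzag_l1Norm {P : ℝ} (hP : 0 < P) (c : ℝ) (J : ℕ) {N : ℕ} (hN : 1 ≤ N) :
    ∃ Q : MvPolynomial ι ℝ,
      (Q.totalDegree : ℝ) ≤ ((J : ℝ) + 1) * (2 ^ (J + 2) + 150 * (4 * π * N / P) * Fintype.card ι) ∧
      ∀ x : ι → ℝ, (∀ i, x i ∈ Set.Icc (-1 : ℝ) 1) →
        |P / (2 * π) * Real.arccos (Real.cos (2 * π * ((∑ i, |x i|) - c) / P)) - MvPolynomial.eval x Q| ≤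
          P / (2 * π ^ 2 * N) + 2 * ((P * ((J : ℝ) + 1) / 4 + 16 * Fintype.card ι / π * (1 + Real.log N)) / 2 ^ J) := by
  set d : ℝ := (Fintype.card ι : ℝ) with hd
  have hd0 : 0 ≤ d := Nat.cast_nonneg _
  have hπ := Real.pi_pos
  -- data of the trigonometric approximation
  set ω : ℕ → ℝ := fun i => 2 * π * (2 * (i : ℝ) + 1) / P with hω
  set a : ℕ → ℝ := fun i => -(2 * P / (π ^ 2 * (2 * (i : ℝ) + 1) ^ 2)) * Real.cos (ω i * c) with ha
  set b : ℕ → ℝ := fun i => -(2 * P / (π ^ 2 * (2 * (i : ℝ) + 1) ^ 2)) * Real.sin (ω i * c) with hb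
  have hω0 : ∀ i, 0 ≤ ω i := fun i => by positivity
  have hωΩ : ∀ i, i < N → ω i ≤ 4 * π * N / P := by
    intro i hi
    simp only [hω]
    rw [div_le_div_iff_of_pos_right hP]
    have : (i : ℝ) + 1 ≤ N := by exact_mod_cast hi
    nlinarith
  have hΩ : 0 ≤ 4 * π * N / P := by positivity
  have happrox : ∀ s : ℝ, 0 ≤ s → s ≤ Fintype.card ι →
      |P / (2 * π) * Real.arccos (Real.cos (2 * π * (s - c) / P)) -
          (P / 4 + ∑ i ∈ range N, (a i * Real.cos (ω i * s) + b i * Real.sin (ω i * s)))| ≤ P / (2 * π ^ 2 * N) := by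
    intro s _ _
    have h := abs_arccos_cos_sub_partialSum_le (2 * π * (s - c) / P) hN
    have hterm : ∀ i ∈ range N, a i * Real.cos (ω i * s) + b i * Real.sin (ω i * s) =
        -(P / (2 * π) * (4 / π * (Real.cos ((2 * i + 1) * (2 * π * (s - c) / P)) / (2 * i + 1) ^ 2))) := by
      intro i _
      have eω : (2 * i + 1) * (2 * π * (s - c) / P) = ω i * s - ω i * c := by simp only [hω]; field_simp
      rw [eω, Real.cos_sub]
      simp only [ha, hb]
      field_simp
      ring
    have e : P / (2 * π) * Real.arccos (Real.cos (2 * π * (s - c) / P)) -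
          (P / 4 + ∑ i ∈ range N, (a i * Real.cos (ω i * s) + b i * Real.sin (ω i * s))) =
        P / (2 * π) * (Real.arccos (Real.cos (2 * π * (s - c) / P)) -
          (π / 2 - 4 / π * ∑ i ∈ range N, Real.cos ((2 * i + 1) * (2 * π * (s - c) / P)) / (2 * i + 1) ^ 2)) := by
      rw [Finset.sum_congr rfl hterm, Finset.sum_neg_distrib, ← Finset.mul_sum, ← Finset.mul_sum]
      field_simp
      ring
    rw [e, abs_mul, abs_of_pos (by positivity : (0 : ℝ) < P / (2 * π))]
    calc P / (2 * π) * |_| ≤ P / (2 * π) * (1 / (π * N)) := mul_le_mul_of_nonneg_left h (by positivity)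
      _ = P / (2 * π ^ 2 * N) := by field_simp
  obtain ⟨Q, hdeg, herr⟩ := exists_mvPolynomial_near_link_of_trigApprox (ι := ι)
    (h := fun s => P / (2 * π) * Real.arccos (Real.cos (2 * π * (s - c) / P))) (P / 4) a b ω N hΩ hω0 hωΩ happrox J
  refine ⟨Q, hdeg, fun x hx => (herr x hx).trans (add_le_add le_rfl ?_)⟩
  -- the coefficient sum: `|a_i| + |b_i| ≤ 2·2P∕(π²(2i+1)²)`
  have h2J : (0 : ℝ) < 2 ^ J := by positivity
  have hcoef : ∀ i, |a i| + |b i| ≤ 2 * (2 * P / (π ^ 2 * (2 * (i : ℝ) + 1) ^ 2)) := by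
    intro i
    have hm : 0 ≤ 2 * P / (π ^ 2 * (2 * (i : ℝ) + 1) ^ 2) := by positivity
    simp only [ha, hb, abs_mul, abs_neg, abs_of_nonneg hm]
    nlinarith [Real.abs_cos_le_one (ω i * c), Real.abs_sin_le_one (ω i * c)]
  have hterm : ∀ i ∈ range N, (|a i| + |b i|) * (((J : ℝ) + 1 + 4 * ω i * Fintype.card ι) / 2 ^ J) ≤
      2 * (((2 * P / π ^ 2 * ((J : ℝ) + 1)) * (1 / (2 * (i : ℝ) + 1) ^ 2) + (16 * d / π) * (1 / (2 * (i : ℝ) + 1))) / 2 ^ J) := by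
    intro i _
    have hi : (0 : ℝ) < 2 * (i : ℝ) + 1 := by positivity
    have hfac : 0 ≤ ((J : ℝ) + 1 + 4 * ω i * Fintype.card ι) / 2 ^ J := by positivity
    calc (|a i| + |b i|) * (((J : ℝ) + 1 + 4 * ω i * Fintype.card ι) / 2 ^ J)
        ≤ 2 * (2 * P / (π ^ 2 * (2 * (i : ℝ) + 1) ^ 2)) * (((J : ℝ) + 1 + 4 * ω i * Fintype.card ι) / 2 ^ J) :=
          mul_le_mul_of_nonneg_right (hcoef i) hfac
      _ = 2 * (((2 * P / π ^ 2 * ((J : ℝ) + 1)) * (1 / (2 * (i : ℝ) + 1) ^ 2) + (16 * d / π) * (1 / (2 * (i : ℝ) + 1))) / 2 ^ J) := by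
          simp only [hω, hd]
          field_simp
          ring
  refine (Finset.sum_le_sum hterm).trans ?_
  rw [← Finset.mul_sum, ← Finset.sum_div, Finset.sum_add_distrib, ← Finset.mul_sum, ← Finset.mul_sum]
  refine mul_le_mul_of_nonneg_left ?_ zero_le_two
  rw [div_le_div_iff_of_pos_right h2J]
  have hs1 := sum_inv_oddSq_le N
  have hs2 := sum_inv_odd_le N
  have hA : 0 ≤ 2 * P / π ^ 2 * ((J : ℝ) + 1) := by positivity
  have hB : 0 ≤ 16 * d / π := by positivity
  calc 2 * P / π ^ 2 * ((J : ℝ) + 1) * ∑ i ∈ range N, 1 / (2 * (i : ℝ) + 1) ^ 2 + 16 * d / π * ∑ i ∈ range N, 1 / (2 * (i : ℝ) + 1)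
      ≤ 2 * P / π ^ 2 * ((J : ℝ) + 1) * (π ^ 2 / 8) + 16 * d / π * (1 + Real.log N) :=
        add_le_add (mul_le_mul_of_nonneg_left hs1 hA) (mul_le_mul_of_nonneg_left hs2 hB)
    _ = P * ((J : ℝ) + 1) / 4 + 16 * d / π * (1 + Real.log N) := by field_simp; ring

/-! ## §2 ★★ Hinges and piecewise-linear links [folklore] -/

/-- ★★ **THE HINGE `|Σ_i|x_i| − c|`, UNIFORMLY IN THE KINK POSITION.**  For every `c ∈ [0, d]`, every `J` and `N ≥ 1` there is
`Q : MvPolynomial ι ℝ` of total degree `≤ (J+1)(2^{J+2} + 300πN)` with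
`||Σ_i|x_i| − c| − Q(x)| ≤ d∕(π²N) + (d(J+1) + (32d∕π)(1 + log N))∕2^J` on `[−1,1]^ι` (`d = |ι|`; the shifted zigzag of period `2d`, which IS
`|s − c|` for `s, c ∈ [0, d]`).  READING: `N ≍ 2^J∕(75π)`, `t ≍ (J+1)2^{J+3}`: `dist_∞(|S_d − c|, Π_t) ≲ d·log t·(log t + log N + 45)∕t ≲ d·log²t∕t`
— the centred kink that the |monomial| device could not move, at the conjectured ridge rate up to `log²` (nesting: `d∕√t`). [folklore] -/
theorem exists_mvPolynomial_near_hinge_l1Norm {c : ℝ} (hc0 : 0 ≤ c) (hcd : c ≤ Fintype.card ι) (J : ℕ) {N : ℕ} (hN : 1 ≤ N) :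
    ∃ Q : MvPolynomial ι ℝ, (Q.totalDegree : ℝ) ≤ ((J : ℝ) + 1) * (2 ^ (J + 2) + 300 * π * N) ∧
      ∀ x : ι → ℝ, (∀ i, x i ∈ Set.Icc (-1 : ℝ) 1) →
        |(|(∑ i, |x i|) - c|) - MvPolynomial.eval x Q| ≤
          Fintype.card ι / (π ^ 2 * N) +
            (Fintype.card ι * ((J : ℝ) + 1) + 32 * Fintype.card ι / π * (1 + Real.log N)) / 2 ^ J := by
  set d : ℝ := (Fintype.card ι : ℝ) with hd
  have hπ := Real.pi_pos
  rcases (Nat.cast_nonneg (Fintype.card ι) : (0 : ℝ) ≤ d).eq_or_lt with hd0 | hdpos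
  · -- `d = 0`: `S ≡ 0`, `c = 0`, the hinge is `0`
    refine ⟨0, ?_, fun x hx => ?_⟩
    · rw [MvPolynomial.totalDegree_zero, Nat.cast_zero]; positivity
    · have hS := l1Norm_mem_Icc x hx
      have hS0 : ∑ i, |x i| = 0 := le_antisymm (hS.2.trans_eq hd0.symm) hS.1
      have hc : c = 0 := le_antisymm (hcd.trans_eq hd0.symm) hc0
      rw [hS0, hc, sub_zero, abs_zero, map_zero, sub_zero, abs_zero]
      have hlog : 0 ≤ Real.log (N : ℝ) := Real.log_natCast_nonneg N
      have hdd : 0 ≤ d := Nat.cast_nonneg _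
      have h1 : 0 ≤ d / (π ^ 2 * N) := div_nonneg hdd (by positivity)
      have h2 : 0 ≤ d * ((J : ℝ) + 1) := mul_nonneg hdd (by positivity)
      have h3 : 0 ≤ 32 * d / π * (1 + Real.log N) := mul_nonneg (div_nonneg (by linarith) hπ.le) (by linarith)
      have h4 : (0 : ℝ) < 2 ^ J := by positivity
      exact add_nonneg h1 (div_nonneg (add_nonneg h2 h3) h4.le)
  -- `d > 0`: the shifted zigzag of period `2d`
  obtain ⟨Q, hdeg, herr⟩ := exists_mvPolynomial_near_shiftedZigzag_l1Norm (ι := ι) (P := 2 * d) (by positivity) c J hN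
  refine ⟨Q, hdeg.trans_eq ?_, fun x hx => ?_⟩
  · have hdne : d ≠ 0 := ne_of_gt hdpos
    rw [← hd]; field_simp; ring
  · have hS := l1Norm_mem_Icc x hx
    rw [← hd] at hS
    have hu : |(∑ i, |x i|) - c| ≤ 2 * d / 2 := by
      rw [abs_le]; constructor <;> linarith [hS.1, hS.2]
    have hz := zigzag_eq_abs (P := 2 * d) (by positivity) hu
    have h := herr x hx
    rw [hz] at h
    refine h.trans_eq ?_
    rw [← hd]
    field_simp
    ring

/-- ★ **PIECEWISE-LINEAR LINKS.**  For `h(s) = α + βs + Σ_{j<K} w_j|s − c_j|` with kinks `c_j ∈ [0, d]`, every `J` and `N ≥ 1` there is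
`Q : MvPolynomial ι ℝ` of total degree `≤ (J+1)(2^{J+2} + 300πN)` with
`|h(Σ_i|x_i|) − Q(x)| ≤ |β|·dπ∕((J+1)2^{J+1}) + (Σ_j|w_j|)·(d∕(π²N) + (d(J+1) + (32d∕π)(1 + log N))∕2^J)` on `[−1,1]^ι`: the affine part by the
additive Jackson approximant of total degree `(J+1)2^{J+2}` (PART 2), each hinge by the previous theorem.  READING: total kink mass `W = Σ|w_j|`
⇒ `≲ (|β| + W)·d·log²t∕t`. [folklore] -/
theorem exists_mvPolynomial_near_piecewiseLinear_l1Norm (α β : ℝ) {K : ℕ} (w c : ℕ → ℝ)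
    (hc : ∀ j, j < K → 0 ≤ c j ∧ c j ≤ Fintype.card ι) (J : ℕ) {N : ℕ} (hN : 1 ≤ N) :
    ∃ Q : MvPolynomial ι ℝ, (Q.totalDegree : ℝ) ≤ ((J : ℝ) + 1) * (2 ^ (J + 2) + 300 * π * N) ∧
      ∀ x : ι → ℝ, (∀ i, x i ∈ Set.Icc (-1 : ℝ) 1) →
        |(α + β * (∑ i, |x i|) + ∑ j ∈ range K, w j * |(∑ i, |x i|) - c j|) - MvPolynomial.eval x Q| ≤
          |β| * (Fintype.card ι * (π / ((J + 1) * 2 ^ (J + 1) : ℕ))) +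
            (∑ j ∈ range K, |w j|) * (Fintype.card ι / (π ^ 2 * N) +
              (Fintype.card ι * ((J : ℝ) + 1) + 32 * Fintype.card ι / π * (1 + Real.log N)) / 2 ^ J) := by
  classical
  set d : ℝ := (Fintype.card ι : ℝ) with hd
  have hπ := Real.pi_pos
  set X : ℝ := ((J : ℝ) + 1) * (2 ^ (J + 2) + 300 * π * N) with hX
  have hX0 : 0 ≤ X := by positivity
  set E : ℝ := d / (π ^ 2 * N) + (d * ((J : ℝ) + 1) + 32 * d / π * (1 + Real.log N)) / 2 ^ J with hE
  -- the affine part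
  obtain ⟨A, hAdeg, hAerr⟩ := exists_additiveJackson (ι := ι) (M := (J + 1) * 2 ^ (J + 1)) (by positivity)
  -- the hinges (for `j ≥ K` use the kink `0`)
  have hc' : ∀ j, 0 ≤ (if j < K then c j else 0) ∧ (if j < K then c j else 0) ≤ Fintype.card ι := by
    intro j; split_ifs with hj
    · exact hc j hj
    · exact ⟨le_rfl, Nat.cast_nonneg _⟩
  choose Hq hHdeg hHerr using fun j => exists_mvPolynomial_near_hinge_l1Norm (ι := ι) (hc' j).1 (hc' j).2 J hN
  set D : ℕ := ⌊X⌋₊ with hD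
  have hHD : ∀ j, (Hq j).totalDegree ≤ D := fun j => Nat.le_floor (hHdeg j)
  have hAD : A.totalDegree ≤ D := by
    refine Nat.le_floor (le_trans (Nat.cast_le.2 hAdeg) ?_)
    have h0 : (0 : ℝ) ≤ ((J : ℝ) + 1) * (300 * π * N) := by positivity
    have hp : (2 : ℝ) ^ (J + 2) = 2 * 2 ^ (J + 1) := by ring
    rw [hX, hp]; push_cast
    nlinarith [h0]
  refine ⟨MvPolynomial.C α + MvPolynomial.C β * A + ∑ j ∈ range K, MvPolynomial.C (w j) * Hq j, ?_, ?_⟩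
  · have hnat : (MvPolynomial.C α + MvPolynomial.C β * A + ∑ j ∈ range K, MvPolynomial.C (w j) * Hq j).totalDegree ≤ D := by
      refine (MvPolynomial.totalDegree_add _ _).trans (max_le ((MvPolynomial.totalDegree_add _ _).trans (max_le ?_ ?_)) ?_)
      · rw [MvPolynomial.totalDegree_C]; exact Nat.zero_le _
      · exact (MvPolynomial.totalDegree_mul _ _).trans (by rw [MvPolynomial.totalDegree_C, zero_add]; exact hAD)
      · refine MvPolynomial.totalDegree_finsetSum_le fun j _ => (MvPolynomial.totalDegree_mul _ _).trans ?_
        rw [MvPolynomial.totalDegree_C, zero_add]; exact hHD j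
    exact (Nat.cast_le.2 hnat).trans (Nat.floor_le hX0)
  · intro x hx
    have hev : MvPolynomial.eval x (MvPolynomial.C α + MvPolynomial.C β * A + ∑ j ∈ range K, MvPolynomial.C (w j) * Hq j) =
        α + β * MvPolynomial.eval x A + ∑ j ∈ range K, w j * MvPolynomial.eval x (Hq j) := by
      rw [map_add, map_add, MvPolynomial.eval_C, map_mul, MvPolynomial.eval_C, map_sum]
      refine congrArg _ (Finset.sum_congr rfl fun j _ => ?_)
      rw [map_mul, MvPolynomial.eval_C]
    rw [hev]
    have e : α + β * (∑ i, |x i|) + ∑ j ∈ range K, w j * |(∑ i, |x i|) - c j| -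
          (α + β * MvPolynomial.eval x A + ∑ j ∈ range K, w j * MvPolynomial.eval x (Hq j)) =
        β * ((∑ i, |x i|) - MvPolynomial.eval x A) +
          ∑ j ∈ range K, w j * (|(∑ i, |x i|) - c j| - MvPolynomial.eval x (Hq j)) := by
      simp only [mul_sub, Finset.sum_sub_distrib]
      ring
    rw [e]
    refine (abs_add_le _ _).trans (add_le_add ?_ ?_)
    · rw [abs_mul]
      exact mul_le_mul_of_nonneg_left (hAerr x hx) (abs_nonneg _)
    · refine (abs_sum_le_sum_abs _ _).trans ?_
      rw [Finset.sum_mul]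
      refine Finset.sum_le_sum fun j hj => ?_
      rw [abs_mul]
      refine mul_le_mul_of_nonneg_left ?_ (abs_nonneg _)
      have h := hHerr j x hx
      rw [if_pos (mem_range.1 hj)] at h
      exact h

/-! ## §3 ★★ The hinge at a prescribed degree budget [folklore] -/
set_option maxHeartbeats 400000 in
/-- ★★ **THE HINGE AT DEGREE `t`: `dist_∞(|Σ_{i≤d}|x_i| − c|, Π_t) ≤ 200·d·log₂t·(log₂t + 7)∕t`** for all `t ≥ 18432`, `c ∈ [0, d]`, `d` — uniformly in
the kink position.  (The dyadic `J` of PART 2b has `J ≥ 8`, so `N = ⌊2^{J+2}∕(300π)⌋ ≥ 1`; then `300πN ≤ 2^{J+2}` keeps the degree `≤ (J+1)2^{J+3} ≤ t`,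
`1∕N ≤ 600π∕2^{J+2}`, `log N ≤ (J+2)log 2`, and `1∕2^J ≤ 16(J+2)∕t`, `J + 3 ≤ log₂t`.) [folklore] -/
theorem exists_mvPolynomial_near_hinge_l1Norm_degree {t : ℕ} (ht : 18432 ≤ t) {c : ℝ} (hc0 : 0 ≤ c) (hcd : c ≤ Fintype.card ι) :
    ∃ Q : MvPolynomial ι ℝ, Q.totalDegree ≤ t ∧
      ∀ x : ι → ℝ, (∀ i, x i ∈ Set.Icc (-1 : ℝ) 1) →
        |(|(∑ i, |x i|) - c|) - MvPolynomial.eval x Q| ≤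
          200 * Fintype.card ι * Real.logb 2 t * (Real.logb 2 t + 7) / t := by
  set d : ℝ := (Fintype.card ι : ℝ) with hd
  have hd0 : 0 ≤ d := Nat.cast_nonneg _
  have hπ := Real.pi_pos
  have hπ3 : π ≤ 3.15 := Real.pi_lt_d2.le
  obtain ⟨J, h1, h2⟩ := exists_dyadicBudget (le_trans (by norm_num) ht)
  obtain ⟨hinv, hlog, htle, hlog3⟩ := dyadicBudget_bounds h1 h2
  set L : ℝ := Real.logb 2 t with hL
  have ht0 : (0 : ℝ) < t := by exact_mod_cast lt_of_lt_of_le (by norm_num) ht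
  have hJ0 : (0 : ℝ) ≤ J := Nat.cast_nonneg _
  -- `J ≥ 8`
  have hJ8 : 8 ≤ J := by
    by_contra hJ
    have hJ7 : J ≤ 7 := by omega
    have : (J + 2) * 2 ^ (J + 4) ≤ 9 * 2 ^ 11 :=
      Nat.mul_le_mul (by omega) (Nat.pow_le_pow_right two_pos (by omega))
    omega
  have h2J2 : (1024 : ℝ) ≤ 2 ^ (J + 2) := by
    have : (2 : ℝ) ^ 10 ≤ 2 ^ (J + 2) := pow_le_pow_right₀ one_le_two (by omega)
    norm_num at this; exact this
  -- the number of modes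
  obtain ⟨N, hN⟩ : ∃ N : ℕ, N = ⌊(2 : ℝ) ^ (J + 2) / (300 * π)⌋₊ := ⟨_, rfl⟩
  have hNle : (N : ℝ) ≤ 2 ^ (J + 2) / (300 * π) := by rw [hN]; exact Nat.floor_le (by positivity)
  have hNlt : (2 : ℝ) ^ (J + 2) / (300 * π) < N + 1 := by rw [hN]; exact Nat.lt_floor_add_one _
  have hN1 : 1 ≤ N := by
    have h1le : (1 : ℝ) ≤ 2 ^ (J + 2) / (300 * π) := by
      rw [le_div_iff₀ (by positivity)]; nlinarith
    rw [hN]; exact Nat.le_floor (by rw [Nat.cast_one]; exact h1le)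
  have hN1r : (1 : ℝ) ≤ N := by exact_mod_cast hN1
  clear hN
  obtain ⟨Q, hdeg, herr⟩ := exists_mvPolynomial_near_hinge_l1Norm (ι := ι) hc0 hcd J hN1
  refine ⟨Q, ?_, fun x hx => (herr x hx).trans ?_⟩
  · -- degree
    have hb : ((J : ℝ) + 1) * (2 ^ (J + 2) + 300 * π * N) ≤ ((J + 1) * 2 ^ (J + 3) : ℕ) := by
      push_cast
      have h3 : 300 * π * (N : ℝ) ≤ 2 ^ (J + 2) := by
        have := mul_le_mul_of_nonneg_left hNle (by positivity : (0 : ℝ) ≤ 300 * π)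
        rwa [mul_div_cancel₀ _ (by positivity : (300 : ℝ) * π ≠ 0)] at this
      calc ((J : ℝ) + 1) * (2 ^ (J + 2) + 300 * π * N) ≤ ((J : ℝ) + 1) * (2 ^ (J + 2) + 2 ^ (J + 2)) :=
            mul_le_mul_of_nonneg_left (add_le_add le_rfl h3) (by positivity)
        _ = ((J : ℝ) + 1) * 2 ^ (J + 3) := by ring
    exact (Nat.cast_le.1 (hdeg.trans hb)).trans h1
  · -- error
    rw [← hd]
    have h2J : (0 : ℝ) < 2 ^ J := by positivity
    -- `1/N ≤ 600π / 2^{J+2} = 150π/2^J`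
    have hinvN : d / (π ^ 2 * N) ≤ 150 * d / (π * 2 ^ J) := by
      rw [div_le_div_iff₀ (by positivity) (by positivity)]
      have hN2 : (2 : ℝ) ^ (J + 2) ≤ 600 * π * N := by
        have : (2 : ℝ) ^ (J + 2) < 300 * π * (N + 1) := by
          rw [div_lt_iff₀ (by positivity)] at hNlt; linarith
        nlinarith
      have e : (2 : ℝ) ^ (J + 2) = 4 * 2 ^ J := by ring
      nlinarith [mul_nonneg hd0 hπ.le]
    -- `log N ≤ (J+2) log 2 ≤ J + 2`
    have hlogN : Real.log N ≤ (J : ℝ) + 2 := by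
      have hNpos : (0 : ℝ) < N := by linarith
      have h300 : (1 : ℝ) ≤ 300 * π := by nlinarith [Real.pi_gt_three]
      have hN2 : (N : ℝ) ≤ 2 ^ (J + 2) := hNle.trans (div_le_self (by positivity) h300)
      have hl2 : Real.log 2 ≤ 1 := by have := Real.log_two_lt_d9; linarith
      calc Real.log N ≤ Real.log (2 ^ (J + 2)) := Real.log_le_log hNpos hN2
        _ = ((J + 2 : ℕ) : ℝ) * Real.log 2 := by rw [Real.log_pow]
        _ ≤ ((J + 2 : ℕ) : ℝ) * 1 := mul_le_mul_of_nonneg_left hl2 (Nat.cast_nonneg _)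
        _ = (J : ℝ) + 2 := by push_cast; ring
    have hA : d * ((J : ℝ) + 1) + 32 * d / π * (1 + Real.log N) ≤ d * (12 * J + 32) := by
      have h32 : 32 / π ≤ (10.2 : ℝ) := by rw [div_le_iff₀ hπ]; nlinarith [Real.pi_gt_d2]
      have hlog0 : 0 ≤ 1 + Real.log N := by linarith [Real.log_nonneg hN1r]
      have : 32 * d / π * (1 + Real.log N) ≤ 10.2 * d * ((J : ℝ) + 3) := by
        calc 32 * d / π * (1 + Real.log N) = 32 / π * (d * (1 + Real.log N)) := by ring
          _ ≤ 10.2 * (d * ((J : ℝ) + 3)) := mul_le_mul h32 (by nlinarith) (by positivity) (by norm_num)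
          _ = 10.2 * d * ((J : ℝ) + 3) := by ring
      nlinarith
    have hB : (d * ((J : ℝ) + 1) + 32 * d / π * (1 + Real.log N)) / 2 ^ J ≤ d * (12 * J + 32) * (16 * ((J : ℝ) + 2) / t) := by
      calc (d * ((J : ℝ) + 1) + 32 * d / π * (1 + Real.log N)) / 2 ^ J
          = (d * ((J : ℝ) + 1) + 32 * d / π * (1 + Real.log N)) * (1 / 2 ^ J) := by ring
        _ ≤ d * (12 * J + 32) * (16 * ((J : ℝ) + 2) / t) :=
            mul_le_mul hA hinv (by positivity) (by positivity)
    have hC : 150 * d / (π * 2 ^ J) ≤ 48 * d * (16 * ((J : ℝ) + 2) / t) := by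
      calc 150 * d / (π * 2 ^ J) = 150 / π * d * (1 / 2 ^ J) := by field_simp
        _ ≤ 48 * d * (16 * ((J : ℝ) + 2) / t) := by
            refine mul_le_mul ?_ hinv (by positivity) (by positivity)
            have : 150 / π ≤ (48 : ℝ) := by rw [div_le_iff₀ hπ]; nlinarith [Real.pi_gt_d2]
            nlinarith
    calc d / (π ^ 2 * N) + (d * ((J : ℝ) + 1) + 32 * d / π * (1 + Real.log N)) / 2 ^ J
        ≤ 48 * d * (16 * ((J : ℝ) + 2) / t) + d * (12 * J + 32) * (16 * ((J : ℝ) + 2) / t) := add_le_add (hinvN.trans hC) hB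
      _ = 16 * d * ((J : ℝ) + 2) * (12 * J + 80) / t := by ring
      _ ≤ 200 * d * L * (L + 7) / t := by
          refine div_le_div_of_nonneg_right ?_ ht0.le
          have hL0 : 0 ≤ L := le_trans (by norm_num) hlog3
          have hL7 : 0 ≤ L + 7 := add_nonneg hL0 (by norm_num)
          have hJL : (J : ℝ) + 2 ≤ L := by linarith only [hlog]
          have h12 : (12 : ℝ) * J + 80 ≤ 12 * (L + 7) := by linarith only [hlog]
          have hdL : 0 ≤ 16 * d * L := by positivity
          calc 16 * d * ((J : ℝ) + 2) * (12 * J + 80) ≤ 16 * d * L * (12 * (L + 7)) :=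
                mul_le_mul (mul_le_mul_of_nonneg_left hJL (by positivity)) h12 (by positivity) hdL
            _ = 192 * (d * L * (L + 7)) := by ring
            _ ≤ 200 * (d * L * (L + 7)) :=
                mul_le_mul_of_nonneg_right (by norm_num) (mul_nonneg (mul_nonneg hd0 hL0) hL7)
            _ = 200 * d * L * (L + 7) := by ring

end Summit.QuantumFields.YangMills.Theorems.BalabanUVNodesN19HingeLinksMultiscale

end
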